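import Summits.CriticalPhenomena.SAWScalingLimit.Theorems.SAWDefectDecoherenceBoundaryClosureRBoundaryDataTransferArmsPrep
import HarnessLib

/-!
# The root wedge: escape from the root's half-ball along `Re H` (crux `BoundaryClosureR`,
stmt-CriticalPhenomena-14004, line `pick-half-plane`, stub `stub_rootWedgeOfNoMax`)

Support file (topic: the LATTICE half of the discrete maximum principle behind
`stub_rootWedgeOfNoMax : RootNoInteriorMax → LocalSupBound → RootWedgeBound`).

Setting: `Λ` simply connected, a flat floor `k₁ ≤ k ≤ k₂` of row `mr` carrying the ROOT
`a = floorEdge ka mr`, a potential `H` of `F dz` (`IsPotential Λ a H`), and a REGION of sites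
`P : Site 2 → Prop` (in the application: `δ·s ∈ closedBall x (r/2)`).

* `re_floorStep_east_nonneg` / `re_floorStep_west_nonpos` / `re_rootStep_eq_zero`: along the floor,
  `Re H` is V-shaped with its minimum at the two root sites — east of the root the eastward step is
  `((2ζ−1)/6)·e^{−i3π/8}·Z_k`, of real part `(√3/6)·sin(3π/8)·Z_k ≥ 0`, west of it
  `((2ζ−1)/6)·e^{+i3π/8}·Z_k`, of real part `≤ 0`, and the root step `−(2ζ−1)/6` is purely imaginary
  (landed `floor_step_eq`, `root_step_eq`);
* `re_le_re_east` / `re_le_re_west`: hence `Re H` does not decrease walking AWAY from the root;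
* `escape`: if every interior site of the region has a neighbour with larger `Re H`
  (`RootNoInteriorMax`), every non-interior site of the region is a floor site, and the floor sites of
  the region lie strictly inside the flat range, then for every lattice site `s₀` of the region there
  is a lattice site `t` ONE STEP OUTSIDE the region (a `𝕋`-neighbour of a lattice site of the region)
  with `Re H s₀ ≤ Re H t` — the maximum over the finite region sits at an interior site (then use its
  larger neighbour, necessarily outside) or at a floor site (then walk away from the root along the
  floor until the region is left).
-/

noncomputable section

open Literature.Probability.LatticeModels Literature.Probability.RandomPlanarGeometry
open Literature.Probability.RandomPlanarGeometry.SAW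
open Summit.CriticalPhenomena.SAWScalingLimit.Theorems.PickHalfPlane.BoundaryExactness
  (floor_step_eq root_step_eq)
open Summit.CriticalPhenomena.SAWScalingLimit.Theorems.PickHalfPlane.BoundaryDataTransfer
  (floorSite_mem_upFace)

namespace Summit.CriticalPhenomena.SAWScalingLimit.Theorems.PickHalfPlane.RootWedge

variable {Λ : Finset HexVertex}

/-! ### Sites of the floor -/

/-- The eastern floor site `![k + 1, m]` is a vertex of `upFace k m`. [folklore] -/
theorem site_succ_mem_upFace (k m : ℤ) : (![k + 1, m] : Site 2) ∈ hexFaceVertices (upFace k m) := by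
  have h : (![k + 1, m] : Site 2) = ![k, m] + Pi.single 0 1 := by ext i; fin_cases i <;> simp
  unfold upFace; rw [mem_hexFaceVertices_zero, h]; exact Or.inr (Or.inl rfl)

/-- The eastern floor site `![k + 1, m]` is a `𝕋`-neighbour of `![k, m]`. [folklore] -/
theorem succ_mem_siteNbrs (k m : ℤ) : (![k + 1, m] : Site 2) ∈ siteNbrs ![k, m] := by
  have h : (![k + 1, m] : Site 2) = ![k, m] + Pi.single 0 1 := by ext i; fin_cases i <;> simp
  rw [h]; simp [siteNbrs]

/-- The western floor site `![k - 1, m]` is a `𝕋`-neighbour of `![k, m]`. [folklore] -/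
theorem pred_mem_siteNbrs (k m : ℤ) : (![k - 1, m] : Site 2) ∈ siteNbrs ![k, m] := by
  have h : (![k - 1, m] : Site 2) = ![k, m] - Pi.single 0 1 := by
    ext i; fin_cases i <;> simp [sub_eq_add_neg]
  rw [h]; simp [siteNbrs]

/-! ### The V-shape of `Re H` along the floor -/

/-- The eastward floor coefficient `((2ζ−1)/6)·e^{−i3π/8}` has real part `(√3/6)·sin(3π/8) ≥ 0`.
[folklore] -/
theorem re_eastCoeff_nonneg :
    0 ≤ ((2 * triZeta - 1) / 3 / 2 * Complex.exp (-(Complex.I * (3 / 8 : ℂ) * Real.pi))).re := by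
  have hsin : 0 < Real.sin (3 / 8 * Real.pi) :=
    Real.sin_pos_of_pos_of_lt_pi (by positivity) (by nlinarith [Real.pi_pos])
  have harg : -(Complex.I * (3 / 8 : ℂ) * Real.pi) = ((-(3 / 8 * Real.pi) : ℝ) : ℂ) * Complex.I := by
    push_cast; ring
  rw [harg, Complex.mul_re, Complex.exp_ofReal_mul_I_re, Complex.exp_ofReal_mul_I_im,
    Real.sin_neg]
  have hre : ((2 * triZeta - 1) / 3 / 2 : ℂ).re = 0 := by
    simp [Complex.div_ofNat_re, triZeta_re]
  have him : ((2 * triZeta - 1) / 3 / 2 : ℂ).im = Real.sqrt 3 / 6 := by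
    simp [Complex.div_ofNat_im, triZeta_im]; ring
  rw [hre, him]
  have h3 : 0 ≤ Real.sqrt 3 := Real.sqrt_nonneg 3
  nlinarith

/-- The westward floor coefficient `((2ζ−1)/6)·e^{+i3π/8}` has real part `−(√3/6)·sin(3π/8) ≤ 0`.
[folklore] -/
theorem re_westCoeff_nonpos :
    ((2 * triZeta - 1) / 3 / 2 * Complex.exp (Complex.I * (3 / 8 : ℂ) * Real.pi)).re ≤ 0 := by
  have hsin : 0 < Real.sin (3 / 8 * Real.pi) :=
    Real.sin_pos_of_pos_of_lt_pi (by positivity) (by nlinarith [Real.pi_pos])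
  have harg : Complex.I * (3 / 8 : ℂ) * Real.pi = (((3 / 8 * Real.pi) : ℝ) : ℂ) * Complex.I := by
    push_cast; ring
  rw [harg, Complex.mul_re, Complex.exp_ofReal_mul_I_re, Complex.exp_ofReal_mul_I_im]
  have hre : ((2 * triZeta - 1) / 3 / 2 : ℂ).re = 0 := by
    simp [Complex.div_ofNat_re, triZeta_re]
  have him : ((2 * triZeta - 1) / 3 / 2 : ℂ).im = Real.sqrt 3 / 6 := by
    simp [Complex.div_ofNat_im, triZeta_im]; ring
  rw [hre, him]
  have h3 : 0 ≤ Real.sqrt 3 := Real.sqrt_nonneg 3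
  nlinarith

/-- **East of the root `Re H` does not decrease eastward; at the root the step is purely
imaginary.**  For `ka ≤ k ≤ k₂` on the flat floor: `Re H(k, mr) ≤ Re H(k+1, mr)`.
[cite: DuminilCopinSmirnov2012, §4 (the map H with dH = F dz)] -/
theorem re_floorStep_east (hΛ : hexDomainSimplyConnected Λ) {mr k₁ k₂ ka : ℤ}
    (hF : ∀ k : ℤ, k₁ ≤ k → k ≤ k₂ → ((![k, mr], 0) : HexVertex) ∈ Λ ∧
      ((![k, mr - 1], 1) : HexVertex) ∉ Λ ∧ (k < k₂ → ((![k, mr], 1) : HexVertex) ∈ Λ))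
    (hka₁ : k₁ ≤ ka) (hka₂ : ka ≤ k₂) {H : Site 2 → ℂ} (hH : IsPotential Λ (floorEdge ka mr) H)
    {k : ℤ} (hk : ka ≤ k) (hk₂ : k ≤ k₂) : (H ![k, mr]).re ≤ (H ![k + 1, mr]).re := by
  rcases hk.lt_or_eq with hlt | heq
  · have hstep := (floor_step_eq hΛ hF hka₁ hka₂ hH (le_trans hka₁ hk) hk₂).1 hlt
    have hre := congrArg Complex.re hstep
    rw [Complex.sub_re, Complex.re_mul_ofReal] at hre
    have := mul_nonneg re_eastCoeff_nonneg (norm_nonneg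
      (hexParafermionicObservable Λ (floorEdge ka mr) hexCriticalFugacity 0 (floorEdge k mr)))
    linarith
  · subst heq
    have hstep := root_step_eq (hF ka hka₁ hka₂).1 (hF ka hka₁ hka₂).2.1 hH
    have hre := congrArg Complex.re hstep
    rw [Complex.sub_re, Complex.neg_re] at hre
    have h0 : ((2 * triZeta - 1) / 3 / 2 : ℂ).re = 0 := by
      simp [Complex.div_ofNat_re, triZeta_re]
    linarith

/-- **West of the root `Re H` does not decrease westward.**  For `k₁ ≤ k ≤ ka` on the flat floor:
`Re H(k+1, mr) ≤ Re H(k, mr)`. [cite: DuminilCopinSmirnov2012, §4 (the map H with dH = F dz)] -/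
theorem re_floorStep_west (hΛ : hexDomainSimplyConnected Λ) {mr k₁ k₂ ka : ℤ}
    (hF : ∀ k : ℤ, k₁ ≤ k → k ≤ k₂ → ((![k, mr], 0) : HexVertex) ∈ Λ ∧
      ((![k, mr - 1], 1) : HexVertex) ∉ Λ ∧ (k < k₂ → ((![k, mr], 1) : HexVertex) ∈ Λ))
    (hka₁ : k₁ ≤ ka) (hka₂ : ka ≤ k₂) {H : Site 2 → ℂ} (hH : IsPotential Λ (floorEdge ka mr) H)
    {k : ℤ} (hk₁ : k₁ ≤ k) (hk : k ≤ ka) : (H ![k + 1, mr]).re ≤ (H ![k, mr]).re := by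
  rcases hk.lt_or_eq with hlt | heq
  · have hstep := (floor_step_eq hΛ hF hka₁ hka₂ hH hk₁ (le_trans hk hka₂)).2 hlt
    have hre := congrArg Complex.re hstep
    rw [Complex.sub_re, Complex.re_mul_ofReal] at hre
    have := mul_nonpos_of_nonpos_of_nonneg re_westCoeff_nonpos (norm_nonneg
      (hexParafermionicObservable Λ (floorEdge ka mr) hexCriticalFugacity 0 (floorEdge k mr)))
    linarith
  · subst heq
    have hstep := root_step_eq (hF k hka₁ hka₂).1 (hF k hka₁ hka₂).2.1 hH
    have hre := congrArg Complex.re hstep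
    rw [Complex.sub_re, Complex.neg_re] at hre
    have h0 : ((2 * triZeta - 1) / 3 / 2 : ℂ).re = 0 := by
      simp [Complex.div_ofNat_re, triZeta_re]
    linarith

/-- **Walking east away from the root.**  From a floor site `k ≥ ka`, `n` eastward steps inside the
flat range do not decrease `Re H`. [cite: DuminilCopinSmirnov2012, §4 (the map H with dH = F dz)] -/
theorem re_le_re_east (hΛ : hexDomainSimplyConnected Λ) {mr k₁ k₂ ka : ℤ}
    (hF : ∀ k : ℤ, k₁ ≤ k → k ≤ k₂ → ((![k, mr], 0) : HexVertex) ∈ Λ ∧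
      ((![k, mr - 1], 1) : HexVertex) ∉ Λ ∧ (k < k₂ → ((![k, mr], 1) : HexVertex) ∈ Λ))
    (hka₁ : k₁ ≤ ka) (hka₂ : ka ≤ k₂) {H : Site 2 → ℂ} (hH : IsPotential Λ (floorEdge ka mr) H)
    {k : ℤ} (hk : ka ≤ k) :
    ∀ n : ℕ, k + n ≤ k₂ + 1 → (H ![k, mr]).re ≤ (H ![k + n, mr]).re
  | 0, _ => by simp
  | n + 1, h => by
    have ih := re_le_re_east hΛ hF hka₁ hka₂ hH hk n (by push_cast at h; omega)
    have hstep := re_floorStep_east hΛ hF hka₁ hka₂ hH (k := k + n) (by omega)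
      (by push_cast at h; omega)
    have hcast : k + ((n + 1 : ℕ) : ℤ) = k + n + 1 := by push_cast; ring
    rw [hcast]
    exact ih.trans hstep

/-- **Walking west away from the root.**  From a floor site `k ≤ ka + 1`, `n` westward steps inside
the flat range do not decrease `Re H`. [cite: DuminilCopinSmirnov2012, §4 (the map H with dH = F dz)] -/
theorem re_le_re_west (hΛ : hexDomainSimplyConnected Λ) {mr k₁ k₂ ka : ℤ}
    (hF : ∀ k : ℤ, k₁ ≤ k → k ≤ k₂ → ((![k, mr], 0) : HexVertex) ∈ Λ ∧
      ((![k, mr - 1], 1) : HexVertex) ∉ Λ ∧ (k < k₂ → ((![k, mr], 1) : HexVertex) ∈ Λ))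
    (hka₁ : k₁ ≤ ka) (hka₂ : ka ≤ k₂) {H : Site 2 → ℂ} (hH : IsPotential Λ (floorEdge ka mr) H)
    {k : ℤ} (hk : k ≤ ka + 1) :
    ∀ n : ℕ, k₁ + n ≤ k → (H ![k, mr]).re ≤ (H ![k - n, mr]).re
  | 0, _ => by simp
  | n + 1, h => by
    have ih := re_le_re_west hΛ hF hka₁ hka₂ hH hk n (by push_cast at h; omega)
    have hstep := re_floorStep_west hΛ hF hka₁ hka₂ hH (k := k - n - 1) (by push_cast at h; omega)
      (by omega)
    have hcast : k - ((n + 1 : ℕ) : ℤ) = k - n - 1 := by push_cast; ring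
    have hcast' : k - (n : ℤ) - 1 + 1 = k - n := by ring
    rw [hcast'] at hstep
    rw [hcast]
    exact ih.trans hstep

/-! ### Escape from the region -/

/-- **Escape lemma (the lattice half of the maximum principle on the root's half-ball).**  Let `Λ`
be simply connected with a flat floor `k₁ ≤ k ≤ k₂` of row `mr` through the root `floorEdge ka mr`,
`H` a potential, and `P` a region of sites such that: every INTERIOR site of the region has a
`𝕋`-neighbour with strictly larger `Re H`; every non-interior lattice site of the region lies on
the floor row `mr`; and every floor site of the region has its column strictly inside `(k₁, k₂)`.
Then for every lattice site `s₀` of the region there are a lattice site `s` of the region and a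
`𝕋`-neighbour `t` of `s` which is a lattice site OUTSIDE the region with `Re H s₀ ≤ Re H t`.
[cite: DuminilCopinSmirnov2012, §4 (the map H with dH = F dz)] -/
theorem escape (hΛ : hexDomainSimplyConnected Λ) {mr k₁ k₂ ka : ℤ}
    (hF : ∀ k : ℤ, k₁ ≤ k → k ≤ k₂ → ((![k, mr], 0) : HexVertex) ∈ Λ ∧
      ((![k, mr - 1], 1) : HexVertex) ∉ Λ ∧ (k < k₂ → ((![k, mr], 1) : HexVertex) ∈ Λ))
    (hka₁ : k₁ ≤ ka) (hka₂ : ka ≤ k₂) {H : Site 2 → ℂ} (hH : IsPotential Λ (floorEdge ka mr) H)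
    (P : Site 2 → Prop)
    (hmax : ∀ s : Site 2, IsInteriorSite Λ s → P s → ∃ t ∈ siteNbrs s, (H s).re < (H t).re)
    (hrow : ∀ s : Site 2, IsLatticeSite Λ s → ¬ IsInteriorSite Λ s → P s → s 1 = mr)
    (hcol : ∀ k : ℤ, P ![k, mr] → k₁ < k ∧ k < k₂)
    {s₀ : Site 2} (hs₀ : IsLatticeSite Λ s₀) (hP₀ : P s₀) :
    ∃ s t : Site 2, IsLatticeSite Λ s ∧ P s ∧ t ∈ siteNbrs s ∧ IsLatticeSite Λ t ∧ ¬ P t ∧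
      (H s₀).re ≤ (H t).re := by
  classical
  set S : Finset (Site 2) := (Λ.biUnion fun f => hexFaceVertices f).filter fun s => P s with hS
  have hmemS : ∀ t : Site 2, t ∈ S ↔ IsLatticeSite Λ t ∧ P t := fun t => by
    simp only [hS, Finset.mem_filter, Finset.mem_biUnion, IsLatticeSite]
  have hs₀S : s₀ ∈ S := (hmemS s₀).2 ⟨hs₀, hP₀⟩
  obtain ⟨s, hsS, hmx⟩ := S.exists_max_image (fun t => (H t).re) ⟨s₀, hs₀S⟩
  obtain ⟨hsL, hsP⟩ := (hmemS s).1 hsS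
  have h0 : (H s₀).re ≤ (H s).re := hmx s₀ hs₀S
  by_cases hint : IsInteriorSite Λ s
  · obtain ⟨t, ht, hlt⟩ := hmax s hint hsP
    have htL : IsLatticeSite Λ t := isLatticeSite_of_mem_siteNbrs hint ht
    have hnP : ¬ P t := fun hPt => by
      have := hmx t ((hmemS t).2 ⟨htL, hPt⟩)
      linarith
    exact ⟨s, t, hsL, hsP, ht, htL, hnP, h0.trans hlt.le⟩
  · have hs1 : s 1 = mr := hrow s hsL hint hsP
    have hsv : s = ![s 0, mr] := by
      ext i; fin_cases i
      · simp
      · simp [hs1]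
    set k : ℤ := s 0 with hk
    have hPk : P ![k, mr] := hsv ▸ hsP
    obtain ⟨hk₁, hk₂⟩ := hcol k hPk
    rcases le_or_gt ka k with hka | hka
    · -- walk east
      have hex : ∃ n : ℕ, ¬ P ![k + n, mr] := by
        refine ⟨(k₂ - k).toNat, fun h => ?_⟩
        have := (hcol _ h).2
        rw [Int.toNat_of_nonneg (by omega)] at this
        omega
      set n := Nat.find hex with hn
      have hnP : ¬ P ![k + n, mr] := Nat.find_spec hex
      have hbelow : ∀ j : ℕ, j < n → P ![k + j, mr] := fun j hj => by
        have := Nat.find_min hex (hn ▸ hj)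
        tauto
      have hn0 : n ≠ 0 := by
        intro h0
        rw [h0] at hnP
        simp only [Nat.cast_zero, add_zero] at hnP
        exact hnP hPk
      obtain ⟨n', hn'⟩ := Nat.exists_eq_succ_of_ne_zero hn0
      have hPn' : P ![k + n', mr] := hbelow n' (by omega)
      have hn'₂ : k + n' < k₂ := (hcol _ hPn').2
      have hmono := re_le_re_east hΛ hF hka₁ hka₂ hH hka n (by omega)
      have hface : upFace (k + n') mr ∈ Λ := (hF (k + n') (by omega) (by omega)).1
      have hcast : k + (n : ℤ) = k + n' + 1 := by rw [hn']; push_cast; ring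
      refine ⟨![k + n', mr], ![k + n, mr], ⟨_, hface, floorSite_mem_upFace _ _⟩, hPn', ?_,
        ⟨_, hface, ?_⟩, hnP, ?_⟩
      · rw [hcast]; exact succ_mem_siteNbrs _ _
      · rw [hcast]; exact site_succ_mem_upFace _ _
      · calc (H s₀).re ≤ (H s).re := h0
          _ = (H ![k, mr]).re := by rw [← hsv]
          _ ≤ (H ![k + n, mr]).re := hmono
    · -- walk west
      have hex : ∃ n : ℕ, ¬ P ![k - n, mr] := by
        refine ⟨(k - k₁).toNat, fun h => ?_⟩
        have := (hcol _ h).1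
        rw [Int.toNat_of_nonneg (by omega)] at this
        omega
      set n := Nat.find hex with hn
      have hnP : ¬ P ![k - n, mr] := Nat.find_spec hex
      have hbelow : ∀ j : ℕ, j < n → P ![k - j, mr] := fun j hj => by
        have := Nat.find_min hex (hn ▸ hj)
        tauto
      have hn0 : n ≠ 0 := by
        intro h0
        rw [h0] at hnP
        simp only [Nat.cast_zero, sub_zero] at hnP
        exact hnP hPk
      obtain ⟨n', hn'⟩ := Nat.exists_eq_succ_of_ne_zero hn0
      have hPn' : P ![k - n', mr] := hbelow n' (by omega)
      have hn'₁ : k₁ < k - n' := (hcol _ hPn').1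
      have hmono := re_le_re_west hΛ hF hka₁ hka₂ hH (show k ≤ ka + 1 by omega) n (by omega)
      have hface : upFace (k - n) mr ∈ Λ := (hF (k - n) (by omega) (by omega)).1
      have hcast : k - (n' : ℤ) = k - n + 1 := by rw [hn']; push_cast; ring
      refine ⟨![k - n', mr], ![k - n, mr], ⟨_, hface, ?_⟩, hPn', ?_,
        ⟨_, hface, floorSite_mem_upFace _ _⟩, hnP, ?_⟩
      · rw [hcast]; exact site_succ_mem_upFace _ _
      · have : (![k - n, mr] : Site 2) = ![k - n' - 1, mr] := by
          congr 1; rw [hcast]; ring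
        rw [this]; exact pred_mem_siteNbrs _ _
      · calc (H s₀).re ≤ (H s).re := h0
          _ = (H ![k, mr]).re := by rw [← hsv]
          _ ≤ (H ![k - n, mr]).re := hmono

/-- **Registered piece `rootWedge_escape`** of stub `stub_rootWedgeOfNoMax` (crux
stmt-CriticalPhenomena-14004, line `pick-half-plane`): the escape lemma in registry form (one
`∀`-term; see `escape`). [cite: DuminilCopinSmirnov2012, §4 (the map H with dH = F dz)] -/
theorem rootWedge_escape : ∀ (Λ : Finset HexVertex), hexDomainSimplyConnected Λ → ∀ (mr k₁ k₂ ka : ℤ), (∀ k : ℤ, k₁ ≤ k → k ≤ k₂ → ((![k, mr], 0) : HexVertex) ∈ Λ ∧ ((![k, mr - 1], 1) : HexVertex) ∉ Λ ∧ (k < k₂ → ((![k, mr], 1) : HexVertex) ∈ Λ)) → k₁ ≤ ka → ka ≤ k₂ → ∀ (H : Site 2 → ℂ), IsPotential Λ (floorEdge ka mr) H → ∀ (P : Site 2 → Prop), (∀ s : Site 2, IsInteriorSite Λ s → P s → ∃ t ∈ siteNbrs s, (H s).re < (H t).re) → (∀ s : Site 2, IsLatticeSite Λ s → ¬ IsInteriorSite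 Λ s → P s → s 1 = mr) → (∀ k : ℤ, P ![k, mr] → k₁ < k ∧ k < k₂) → ∀ (s₀ : Site 2), IsLatticeSite Λ s₀ → P s₀ → ∃ s t : Site 2, IsLatticeSite Λ s ∧ P s ∧ t ∈ siteNbrs s ∧ IsLatticeSite Λ t ∧ ¬ P t ∧ (H s₀).re ≤ (H t).re :=
  fun _ hΛ _ _ _ _ hF hka₁ hka₂ _ hH P hmax hrow hcol _ hs₀ hP₀ =>
    escape hΛ hF hka₁ hka₂ hH P hmax hrow hcol hs₀ hP₀

end Summit.CriticalPhenomena.SAWScalingLimit.Theorems.PickHalfPlane.RootWedge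

end
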